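import Summits.NavierStokesRegularity.FluidComputer.RowSwitchSound
import Literature.Analysis.ODE.MaximalTime
import Literature.Analysis.ODE.OneSidedComparison
import HarnessLib

/-!
# `RowSwitchWindow`: the window lemma of the stage hand-over — the bounds `|I| ≤ B`, `|d| < wid` that
# `RowSwitchSound.switchStage_hu0` takes as hypotheses, proved from the Boolean `swStageOK`
# (`pub-fluidc-bp3/R1-DESIGN.md` §10.6, layer B′ of the Lean row checker)

HONEST FRAMING (cell `pub-fluidc`, blueprint seat bp3, gen 22): low prior, high value-of-information
experiment on Tao's machine paradigm; NOT a claim that NS blows up. No fluid mechanics: a closed-condition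
continuity (bootstrap) argument for the ODE with defect `ẏ = F(y) + δF` on the switch window.

Setting (a stage switch `r | r'`, certificate `c`, `swStageOK r r' c`; everything at the rows' scale
`2^P`): `X0 = x̂'(0)` the new row's reference point, `F0 = F(X0)`, `J0 = J(X0)`, `σ` the old member time
at the switch, `e = y(σ) − X0` with `|e| ≤ Ē` (the old row's end state box), the window
`W = [σ − Ds, σ + Ds]`, on which `y` solves the ODE with `|δF| ≤ DELw := max(DEL, DEL')`, and
`I(ξ) := y(ξ) − y(σ) − (ξ − σ) F0` (so that `d(ξ) := y(ξ) − X0 = e + (ξ − σ) F0 + I(ξ)` and, by the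
homogeneous quadratic Taylor split `ChainField.taylor_split_mat`, `İ = J0 d + F(d) + δF`).

* `box_bootstrap` — the generic closed-condition continuity step on a box: if `|G(s₀)| ≤ α ≤ β`,
  `|Ġ| ≤ ρ` wherever `|G| ≤ β`, and `α + h ρ < β` (STRICT), then `|G| ≤ β` on `[s₀, s₀ + h]`
  (`Literature.Analysis.ODE.maximalTimeP`: the condition is closed, holds strictly at the maximal
  time, hence eventually beyond it unless the clock ran out).
* `abs_dev_le` — the pointwise estimate behind (B_j): where `|I| ≤ b_{j+1}` and `|ξ − σ| ≤ (j+1) h`,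
  `|d| ≤ Ē + (j+1) h |F0| + b_{j+1}` and `|d| < wid` (by (W)), so `|İ| ≤ |J0| (…) + Fabs(wid) + DELw`
  — exactly the kernel's integer majorant `rho`, read through `⌈·⌉` roundings.
* `window_half` — sixteen bootstraps along the sub-windows (induction on `Fin 17`, the monotone
  majorant table (M) carrying the start of each step), for a trajectory run forward (`ε = 1`) or
  backward (`ε = −1`, time reversed) from `σ`; `window_I` — both halves: `|I| ≤ B := b_16` on `W`;
  `window_d` — `|d| < wid` on `W`.
* the assembled stage hand-over `switchStage_sound` (these window facts fed into
  `RowSwitchSound.switchStage_hu0`) is `RowSwitchStage.lean`.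

[cite: Tao2016AveragedNS, §5.5 Thm 5.3 (5.5)]
-/

namespace Summit.NavierStokesRegularity.FluidComputer

open Literature.Analysis.FluidPDE.FluidComputer
open Literature.Analysis.ValidatedNumerics.Numerics (cdiv div_le_cdiv)
open Literature.Analysis.ODE

namespace RowCheck

open DIVec ChainField Finset Real Set Matrix Filter Topology

/-! ### The generic bootstrap step -/

/-- **Closed-condition continuity on a box.** `G : ℝ → (Fin n → ℝ)` differentiable on `[s₀, s₀ + h]`
with `|Ġ_a| ≤ ρ_a` wherever `|G_b| ≤ β_b` for all `b`; if `|G(s₀)| ≤ α ≤ β` and `α + h ρ < β` then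
`|G| ≤ β` on the whole interval. [folklore] -/
theorem box_bootstrap {n : ℕ} {G G' : ℝ → Fin n → ℝ} {s₀ h : ℝ} {α β ρ : Fin n → ℝ} (hh : 0 ≤ h)
    (hG : ∀ t ∈ Icc s₀ (s₀ + h), ∀ a, HasDerivAt (fun τ => G τ a) (G' t a) t)
    (hρ : ∀ t ∈ Icc s₀ (s₀ + h), (∀ b, |G t b| ≤ β b) → ∀ a, |G' t a| ≤ ρ a)
    (h0 : ∀ a, |G s₀ a| ≤ α a) (hαβ : ∀ a, α a ≤ β a) (hroom : ∀ a, 0 ≤ ρ a → α a + h * ρ a < β a) :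
    ∀ t ∈ Icc s₀ (s₀ + h), ∀ a, |G t a| ≤ β a := by
  have hab : s₀ ≤ s₀ + h := by linarith
  have hQ0 : ∀ a, |G s₀ a| ≤ β a := fun a => (h0 a).trans (hαβ a)
  have hcont : ∀ a, ContinuousOn (fun τ => |G τ a|) (Icc s₀ (s₀ + h)) :=
    fun a t ht => ((hG t ht a).continuousAt.continuousWithinAt).abs
  have hclosed : ∀ t ∈ Ioc s₀ (s₀ + h), (∀ s ∈ Ico s₀ t, ∀ a, |G s a| ≤ β a) → ∀ a, |G t a| ≤ β a :=
    fun t ht hs a => le_const_of_forall_Ico (hcont a) ht fun s hs' => hs s hs' a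
  set T := maximalTimeP (fun t => ∀ a, |G t a| ≤ β a) s₀ (s₀ + h) with hT
  have hTmem : T ∈ Icc s₀ (s₀ + h) := maximalTimeP_mem (P := fun t => ∀ a, |G t a| ≤ β a) hab hQ0
  have hQT : ∀ t ∈ Icc s₀ T, ∀ a, |G t a| ≤ β a := fun t ht =>
    maximalTimeP_spec (P := fun t => ∀ a, |G t a| ≤ β a) hab hQ0 hclosed ht
  have hder : ∀ t ∈ Icc s₀ T, ∀ a, |G' t a| ≤ ρ a := fun t ht =>
    hρ t ⟨ht.1, ht.2.trans hTmem.2⟩ (hQT t ht)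
  have hρ0 : ∀ a, 0 ≤ ρ a := fun a => (abs_nonneg _).trans (hder s₀ ⟨le_rfl, hTmem.1⟩ a)
  have hmvt : ∀ a, |G T a - G s₀ a| ≤ ρ a * (T - s₀) := fun a =>
    abs_sub_le_mul_of_abs_deriv_right_le (f := fun τ => G τ a) (f' := fun τ => G' τ a)
      (fun t ht => (hG t ⟨ht.1, ht.2.trans hTmem.2⟩ a).continuousAt.continuousWithinAt)
      (fun x hx => (hG x ⟨hx.1, hx.2.le.trans hTmem.2⟩ a).hasDerivWithinAt)
      (fun x hx => hder x ⟨hx.1, hx.2.le⟩ a) T ⟨hTmem.1, le_rfl⟩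
  have hstrict : ∀ a, |G T a| < β a := by
    intro a
    have h1 : |G T a| ≤ |G s₀ a| + |G T a - G s₀ a| := by
      have h := abs_add_le (G s₀ a) (G T a - G s₀ a)
      rwa [add_sub_cancel] at h
    have h2 : ρ a * (T - s₀) ≤ h * ρ a := by
      have : T - s₀ ≤ h := by linarith [hTmem.2]
      nlinarith [hρ0 a]
    linarith [h0 a, hmvt a, hroom a (hρ0 a)]
  have hTeq : T = s₀ + h := by
    by_contra hne
    have hlt : T < s₀ + h := lt_of_le_of_ne hTmem.2 hne
    refine not_eventually_of_maximalTimeP_lt (P := fun t => ∀ a, |G t a| ≤ β a) hab hQ0 hlt ?_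
    have hev : ∀ a, ∀ᶠ t in 𝓝[Icc s₀ (s₀ + h)] T, |G t a| < β a := fun a =>
      (hcont a T hTmem).eventually_lt_const (hstrict a)
    exact (eventually_all.2 hev).mono fun t ht a => (ht a).le
  intro t ht a
  exact hQT t ⟨ht.1, hTeq ▸ ht.2⟩ a

namespace RowData

variable {r r' : RowData} {c : SwCert}

/-! ### The majorant table -/

namespace SwWin

/-- (M) chained: `b j ≤ b 16`. [folklore] -/
theorem b_le_last (W : SwWin r r' c) : ∀ (j : Fin 17) (a : Fin 9), c.b j a ≤ c.b (Fin.last 16) a := by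
  intro j a
  induction j using Fin.reverseInduction with
  | last => exact le_rfl
  | cast j ih => exact (W.hmono j a).trans ih

end SwWin

/-- The state-box majorant on sub-window `j`: `Ē_b + ⌈h (j+1) |F0|_b⌉ + b_{j+1,b}`. [folklore] -/
def dIn (r r' : RowData) (c : SwCert) (j : Fin 16) (bb : Fin 9) : ℤ :=
  r.Eb bb + cdiv (cdiv c.Ds 16 * ((j : ℕ) + 1 : ℤ) * (r'.F0I bb).mag) (2 ^ r'.P) + c.b j.succ bb

/-- The slope majorant on sub-window `j`: `|J0| dIn + Fabs(wid) + DELw`. [folklore] -/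
def rho (r r' : RowData) (c : SwCert) (j : Fin 16) (a : Fin 9) : ℤ :=
  (∑ bb, cdiv ((r'.J0I a bb).mag * dIn r r' c j bb) (2 ^ r'.P)) + FabsB r'.P r'.cU r'.cD c.wid a +
    max (r.DEL a) (r'.DEL a)

/-! ### The pointwise estimate -/

/-- **The slope estimate behind (B_j)** at one point `x = y(ξ)` of the window (`τ = ±(ξ − σ)`,
`e = y(σ) − X0`): where `|x − X0 − e − τ F0| ≤ b_{j+1}`, `|τ| ≤ (j+1) h` and `|τ| ≤ Ds`, the state is
in the strict window box `|x − X0| < wid` and `|F(x) + δ − F0| ≤ rho_j`. [folklore] -/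
theorem abs_dev_le (W : SwWin r r' c) (G' : r'.GateOK) (j : Fin 16) {x δ e : Fin 9 → ℝ} {τ : ℝ}
    (he : ∀ a, |e a| ≤ (r.Eb a : ℝ) / 2 ^ r'.P)
    (hδ : ∀ a, |δ a| ≤ ((max (r.DEL a) (r'.DEL a) : ℤ) : ℝ) / 2 ^ r'.P)
    (hτ : |τ| ≤ ((j : ℕ) + 1) * (((cdiv c.Ds 16 : ℤ) : ℝ) / 2 ^ r'.P))
    (hτ' : |τ| ≤ (c.Ds : ℝ) / 2 ^ r'.P)
    (hI : ∀ a, |x a - r'.X0R a - e a - τ * F G'.g G'.Λ r'.X0R a| ≤ ((c.b j.succ a : ℤ) : ℝ) / 2 ^ r'.P) :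
    (∀ b, |x b - r'.X0R b| < (c.wid b : ℝ) / 2 ^ r'.P) ∧
    ∀ a, |F G'.g G'.Λ x a + δ a - F G'.g G'.Λ r'.X0R a| ≤ ((rho r r' c j a : ℤ) : ℝ) / 2 ^ r'.P := by
  have hO : (0 : ℝ) < 2 ^ r'.P := by positivity
  set X0 := r'.X0R with hX0
  set F0 := F G'.g G'.Λ r'.X0R with hF0
  set d : Fin 9 → ℝ := fun b => x b - X0 b with hd
  have hF0b : ∀ b, |F0 b| ≤ ((r'.F0I b).mag : ℝ) / 2 ^ r'.P := fun b => DI.abs_le_mag (mem_F0I G' b)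
  have hdec : ∀ b, d b = e b + τ * F0 b + (x b - X0 b - e b - τ * F0 b) := fun b => by simp only [hd]; ring
  have h3 : ∀ b, |d b| ≤ |e b| + |τ * F0 b| + |x b - X0 b - e b - τ * F0 b| := fun b => by
    rw [hdec b]; exact abs_add_three _ _ _
  -- the state box on the sub-window
  have hdin : ∀ b, |d b| ≤ ((dIn r r' c j b : ℤ) : ℝ) / 2 ^ r'.P := by
    intro b
    have h1 : |τ * F0 b| ≤
        ((cdiv (cdiv c.Ds 16 * ((j : ℕ) + 1 : ℤ) * (r'.F0I b).mag) (2 ^ r'.P) : ℤ) : ℝ) / 2 ^ r'.P := by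
      rw [abs_mul]
      calc |τ| * |F0 b| ≤ ((j : ℕ) + 1) * (((cdiv c.Ds 16 : ℤ) : ℝ) / 2 ^ r'.P) *
            (((r'.F0I b).mag : ℝ) / 2 ^ r'.P) :=
            mul_le_mul hτ (hF0b b) (abs_nonneg _) ((abs_nonneg τ).trans hτ)
        _ = ((cdiv c.Ds 16 * ((j : ℕ) + 1 : ℤ) * (r'.F0I b).mag : ℤ) : ℝ) / (((2 : ℤ) ^ r'.P : ℤ) : ℝ) /
            2 ^ r'.P := by push_cast; ring
        _ ≤ _ := div_le_div_of_nonneg_right (div_le_cdiv (by positivity)) hO.le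
    have h := h3 b
    push_cast [dIn]
    rw [add_div, add_div]
    linarith [he b, hI b]
  -- the strict window box (W)
  have hwid : ∀ b, |d b| < (c.wid b : ℝ) / 2 ^ r'.P := by
    intro b
    have h1 : |τ * F0 b| ≤ ((cdiv (c.Ds * (r'.F0I b).mag) (2 ^ r'.P) : ℤ) : ℝ) / 2 ^ r'.P := by
      rw [abs_mul]
      calc |τ| * |F0 b| ≤ (c.Ds : ℝ) / 2 ^ r'.P * (((r'.F0I b).mag : ℝ) / 2 ^ r'.P) :=
            mul_le_mul hτ' (hF0b b) (abs_nonneg _) ((abs_nonneg τ).trans hτ')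
        _ = ((c.Ds * (r'.F0I b).mag : ℤ) : ℝ) / (((2 : ℤ) ^ r'.P : ℤ) : ℝ) / 2 ^ r'.P := by
            push_cast; ring
        _ ≤ _ := div_le_div_of_nonneg_right (div_le_cdiv (by positivity)) hO.le
    have hBb : ((c.b j.succ b : ℤ) : ℝ) / 2 ^ r'.P ≤ ((c.b (Fin.last 16) b : ℤ) : ℝ) / 2 ^ r'.P :=
      div_le_div_of_nonneg_right (by exact_mod_cast W.b_le_last j.succ b) hO.le
    have hWb : ((r.Eb b : ℝ) + ((cdiv (c.Ds * (r'.F0I b).mag) (2 ^ r'.P) : ℤ) : ℝ) +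
        ((c.b (Fin.last 16) b : ℤ) : ℝ)) / 2 ^ r'.P < (c.wid b : ℝ) / 2 ^ r'.P :=
      div_lt_div_of_pos_right (by exact_mod_cast W.hW b) hO
    rw [add_div, add_div] at hWb
    have h := h3 b
    linarith [he b, hI b]
  -- Taylor split at X0
  have hx : x = X0 + d := by ext b; simp [hd]
  have htay : ∀ a, F G'.g G'.Λ x a + δ a - F0 a =
      (Jmat G'.g G'.Λ X0).mulVec d a + F G'.g G'.Λ d a + δ a := by
    intro a; rw [hx, taylor_split_mat]; simp only [Pi.add_apply, hF0, hX0]; ring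
  have hJ : ∀ a, |(Jmat G'.g G'.Λ X0).mulVec d a| ≤
      ((∑ bb, cdiv ((r'.J0I a bb).mag * dIn r r' c j bb) (2 ^ r'.P) : ℤ) : ℝ) / 2 ^ r'.P := by
    intro a
    simp only [Matrix.mulVec, dotProduct]
    exact abs_sum_le_cdiv r'.P (MI := fun bb => r'.J0I a bb)
      (fun bb => mem_JmatI G'.hU G'.hD (fun k => mem_X0I r' k) a bb) hdin
  refine ⟨hwid, fun a => ?_⟩
  rw [htay a]
  have h1 := hJ a
  have h2 := abs_F_le_FabsB G'.hU G'.hD (E := d) (EB := c.wid) (fun k => (hwid k).le) a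
  have h4 := hδ a
  have h5 := abs_add_three ((Jmat G'.g G'.Λ X0).mulVec d a) (F G'.g G'.Λ d a) (δ a)
  push_cast [rho] at h1 h4 ⊢
  rw [add_div, add_div]
  linarith

/-! ### The window lemma -/

/-- **Half window** (sixteen bootstraps): a trajectory `z` on `[σ, σ + Ds]` with
`ż = ε (F(z) + δ)`, `|ε| = 1` (`ε = 1`: the member run forward from `σ`; `ε = −1`: run backward, time
reversed), `|δ| ≤ DELw`, `|z(σ) − X0| ≤ Ē`, satisfies `|z(t) − z(σ) − ε (t − σ) F0| ≤ B`. [folklore] -/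
theorem window_half (W : SwWin r r' c) (G' : r'.GateOK) {z δ : ℝ → Fin 9 → ℝ} {σ ε : ℝ} (hε : |ε| = 1)
    (hz : ∀ t ∈ Icc σ (σ + (c.Ds : ℝ) / 2 ^ r'.P), ∀ a,
      HasDerivAt (fun τ => z τ a) (ε * (F G'.g G'.Λ (z t) a + δ t a)) t)
    (hδ : ∀ t ∈ Icc σ (σ + (c.Ds : ℝ) / 2 ^ r'.P), ∀ a,
      |δ t a| ≤ ((max (r.DEL a) (r'.DEL a) : ℤ) : ℝ) / 2 ^ r'.P)
    (he : ∀ a, |z σ a - r'.X0R a| ≤ (r.Eb a : ℝ) / 2 ^ r'.P) :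
    ∀ t ∈ Icc σ (σ + (c.Ds : ℝ) / 2 ^ r'.P), ∀ a,
      |z t a - z σ a - ε * (t - σ) * F G'.g G'.Λ r'.X0R a| ≤ ((c.b (Fin.last 16) a : ℤ) : ℝ) / 2 ^ r'.P := by
  have hO : (0 : ℝ) < 2 ^ r'.P := by positivity
  set F0 := F G'.g G'.Λ r'.X0R with hF0
  set DsR : ℝ := (c.Ds : ℝ) / 2 ^ r'.P with hDsR
  set hR : ℝ := DsR / 16 with hhR
  have hDs0 : 0 ≤ DsR := by have := W.hDs; positivity
  have hhR0 : 0 ≤ hR := by positivity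
  have hhint : hR ≤ ((cdiv c.Ds 16 : ℤ) : ℝ) / 2 ^ r'.P := by
    rw [hhR, hDsR, div_right_comm]
    refine div_le_div_of_nonneg_right ?_ hO.le
    have h := div_le_cdiv (a := c.Ds) (b := 16) (by norm_num)
    push_cast at h
    exact h
  set I : ℝ → Fin 9 → ℝ := fun t a => z t a - z σ a - ε * (t - σ) * F0 a with hI
  have hId : ∀ t ∈ Icc σ (σ + DsR), ∀ a,
      HasDerivAt (fun τ => I τ a) (ε * (F G'.g G'.Λ (z t) a + δ t a - F0 a)) t := by
    intro t ht a
    have h1 := hz t ht a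
    have h2 : HasDerivAt (fun τ => ε * (τ - σ) * F0 a) (ε * 1 * F0 a) t :=
      (((hasDerivAt_id t).sub_const σ).const_mul ε).mul_const (F0 a)
    have h3 := (h1.sub_const (z σ a)).sub h2
    rw [show ε * (F G'.g G'.Λ (z t) a + δ t a) - ε * 1 * F0 a =
      ε * (F G'.g G'.Λ (z t) a + δ t a - F0 a) by ring] at h3
    simpa only [hI, Pi.sub_def] using h3
  have claim : ∀ i : Fin 17, ∀ t ∈ Icc σ (σ + (i : ℕ) * hR), ∀ a,
      |I t a| ≤ ((c.b i a : ℤ) : ℝ) / 2 ^ r'.P := by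
    intro i
    induction i using Fin.induction with
    | zero =>
      intro t ht a
      have ht' : t = σ := by
        simp only [Fin.val_zero, Nat.cast_zero, zero_mul, add_zero, Set.mem_Icc] at ht; linarith
      subst ht'
      simp only [hI, sub_self, mul_zero, zero_mul, abs_zero]
      have := W.hb0 a
      positivity
    | succ i ih =>
      intro t ht a
      set s : ℝ := σ + (i : ℕ) * hR with hs
      have hi0 : (0 : ℝ) ≤ (i : ℕ) := Nat.cast_nonneg _
      have hi16 : ((i : ℕ) : ℝ) + 1 ≤ 16 := by
        have := i.is_lt; exact_mod_cast this
      have hsσ : σ ≤ s := by rw [hs]; nlinarith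
      have hs1 : σ + ((i.succ : Fin 17) : ℕ) * hR = s + hR := by
        simp only [Fin.val_succ, Nat.cast_add, Nat.cast_one, hs]; ring
      have hsub : Icc s (s + hR) ⊆ Icc σ (σ + DsR) := by
        intro u hu
        refine ⟨hsσ.trans hu.1, hu.2.trans ?_⟩
        rw [hs, hhR]; nlinarith
      have ihs : ∀ a, |I s a| ≤ ((c.b i.castSucc a : ℤ) : ℝ) / 2 ^ r'.P := fun a =>
        ih s ⟨hsσ, by simp only [Fin.val_castSucc, hs]; exact le_rfl⟩ a
      have hboot := box_bootstrap (G := I)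
        (G' := fun t a => ε * (F G'.g G'.Λ (z t) a + δ t a - F0 a)) (s₀ := s) (h := hR)
        (α := fun a => ((c.b i.castSucc a : ℤ) : ℝ) / 2 ^ r'.P)
        (β := fun a => ((c.b i.succ a : ℤ) : ℝ) / 2 ^ r'.P)
        (ρ := fun a => ((rho r r' c i a : ℤ) : ℝ) / 2 ^ r'.P) hhR0
        (fun t ht a => hId t (hsub ht) a)
        (fun t ht hQ a => by
          have htσ : 0 ≤ t - σ := by linarith [hsσ, ht.1]
          have hτ1 : |ε * (t - σ)| ≤ ((i : ℕ) + 1) * (((cdiv c.Ds 16 : ℤ) : ℝ) / 2 ^ r'.P) := by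
            rw [abs_mul, hε, one_mul, abs_of_nonneg htσ]
            have h1 : t - σ ≤ ((i : ℕ) + 1) * hR := by
              have := ht.2; rw [hs] at this; linarith
            exact h1.trans (mul_le_mul_of_nonneg_left hhint (by positivity))
          have hτ2 : |ε * (t - σ)| ≤ (c.Ds : ℝ) / 2 ^ r'.P := by
            rw [abs_mul, hε, one_mul, abs_of_nonneg htσ]
            linarith [(hsub ht).2]
          have h := (abs_dev_le W G' i (x := z t) (δ := δ t) (e := fun a => z σ a - r'.X0R a)
            (τ := ε * (t - σ)) he (hδ t (hsub ht)) hτ1 hτ2 (fun b => by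
              have hb := hQ b
              simp only [hI] at hb
              convert hb using 2
              ring)).2 a
          show |ε * (F G'.g G'.Λ (z t) a + δ t a - F0 a)| ≤ _
          rw [abs_mul, hε, one_mul]
          exact h)
        ihs
        (fun a => div_le_div_of_nonneg_right (by exact_mod_cast W.hmono i a) hO.le)
        (fun a hρ => by
          have hBr : ((c.b i.castSucc a : ℤ) : ℝ) +
              ((cdiv (cdiv c.Ds 16 * rho r r' c i a) (2 ^ r'.P) : ℤ) : ℝ) < ((c.b i.succ a : ℤ) : ℝ) := by
            have hB := W.hB i a
            exact_mod_cast hB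
          have h1 : hR * (((rho r r' c i a : ℤ) : ℝ) / 2 ^ r'.P) ≤
              ((cdiv (cdiv c.Ds 16 * rho r r' c i a) (2 ^ r'.P) : ℤ) : ℝ) / 2 ^ r'.P :=
            calc hR * (((rho r r' c i a : ℤ) : ℝ) / 2 ^ r'.P)
                ≤ ((cdiv c.Ds 16 : ℤ) : ℝ) / 2 ^ r'.P * (((rho r r' c i a : ℤ) : ℝ) / 2 ^ r'.P) :=
                  mul_le_mul_of_nonneg_right hhint hρ
              _ = ((cdiv c.Ds 16 * rho r r' c i a : ℤ) : ℝ) / (((2 : ℤ) ^ r'.P : ℤ) : ℝ) / 2 ^ r'.P := by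
                  push_cast; ring
              _ ≤ _ := div_le_div_of_nonneg_right (div_le_cdiv (by positivity)) hO.le
          have h2 := div_lt_div_of_pos_right hBr hO
          rw [add_div] at h2
          show ((c.b i.castSucc a : ℤ) : ℝ) / 2 ^ r'.P + hR * (((rho r r' c i a : ℤ) : ℝ) / 2 ^ r'.P) <
            ((c.b i.succ a : ℤ) : ℝ) / 2 ^ r'.P
          linarith)
      rcases le_or_gt t s with hts | hts
      · have h := ih t ⟨ht.1, by simp only [Fin.val_castSucc]; rw [hs] at hts; exact hts⟩ a
        exact h.trans (div_le_div_of_nonneg_right (by exact_mod_cast W.hmono i a) hO.le)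
      · exact hboot t ⟨hts.le, by rw [← hs1]; exact ht.2⟩ a
  intro t ht a
  have h16 : σ + ((Fin.last 16 : Fin 17) : ℕ) * hR = σ + DsR := by
    simp only [Fin.val_last, Nat.cast_ofNat, hhR]; ring
  exact claim (Fin.last 16) t (by rw [h16]; exact ht) a

/-- **The window lemma, (i)**: on `W = [σ − Ds, σ + Ds]`, `|y(ξ) − y(σ) − (ξ − σ) F0| ≤ B`. [folklore] -/
theorem window_I (W : SwWin r r' c) (G' : r'.GateOK) {y δF : ℝ → Fin 9 → ℝ} {D : Set ℝ} {σ : ℝ}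
    (hD : Icc (σ - (c.Ds : ℝ) / 2 ^ r'.P) (σ + (c.Ds : ℝ) / 2 ^ r'.P) ⊆ D)
    (hy : ∀ ξ ∈ D, ∀ a, HasDerivAt (fun τ => y τ a) (F G'.g G'.Λ (y ξ) a + δF ξ a) ξ)
    (hδ : ∀ ξ ∈ Icc (σ - (c.Ds : ℝ) / 2 ^ r'.P) (σ + (c.Ds : ℝ) / 2 ^ r'.P), ∀ a,
      |δF ξ a| ≤ ((max (r.DEL a) (r'.DEL a) : ℤ) : ℝ) / 2 ^ r'.P)
    (he : ∀ a, |y σ a - r'.X0R a| ≤ (r.Eb a : ℝ) / 2 ^ r'.P) :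
    ∀ ξ ∈ Icc (σ - (c.Ds : ℝ) / 2 ^ r'.P) (σ + (c.Ds : ℝ) / 2 ^ r'.P), ∀ a,
      |y ξ a - y σ a - (ξ - σ) * F G'.g G'.Λ r'.X0R a| ≤ ((c.b (Fin.last 16) a : ℤ) : ℝ) / 2 ^ r'.P := by
  have hDs0 : 0 ≤ (c.Ds : ℝ) / 2 ^ r'.P := by have := W.hDs; positivity
  have hfwd := window_half W G' (z := y) (δ := δF) (σ := σ) (ε := 1) (by simp)
    (fun t ht a => by simpa using hy t (hD ⟨by linarith [ht.1, ht.2], ht.2⟩) a)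
    (fun t ht a => hδ t ⟨by linarith [ht.1, ht.2], ht.2⟩ a) he
  have hbwd := window_half W G' (z := fun t => y (2 * σ - t)) (δ := fun t => δF (2 * σ - t)) (σ := σ)
    (ε := -1) (by simp)
    (fun t ht a => by
      have hm : 2 * σ - t ∈ D := hD ⟨by linarith [ht.2], by linarith [ht.1, hDs0]⟩
      have h1 := hy (2 * σ - t) hm a
      have h2 : HasDerivAt (fun τ : ℝ => 2 * σ - τ) (-1) t := by
        simpa using (hasDerivAt_id t).const_sub (2 * σ)
      have h3 := h1.scomp t h2
      simpa [Function.comp_def] using h3)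
    (fun t ht a => hδ (2 * σ - t) ⟨by linarith [ht.2], by linarith [ht.1, hDs0]⟩ a)
    (fun a => by
      have h2 : 2 * σ - σ = σ := by ring
      simp only [h2]
      exact he a)
  intro ξ hξ a
  rcases le_total σ ξ with h | h
  · simpa using hfwd ξ ⟨h, hξ.2⟩ a
  · have h1 := hbwd (2 * σ - ξ) ⟨by linarith, by linarith [hξ.1]⟩ a
    have h2 : 2 * σ - σ = σ := by ring
    simp only [sub_sub_cancel, h2] at h1
    convert h1 using 2
    ring

/-- **The window lemma, (ii)**: on `W`, the state is in the strict window box `|y(ξ) − X0| < wid`.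
[folklore] -/
theorem window_d (W : SwWin r r' c) (G' : r'.GateOK) {y δF : ℝ → Fin 9 → ℝ} {D : Set ℝ} {σ : ℝ}
    (hD : Icc (σ - (c.Ds : ℝ) / 2 ^ r'.P) (σ + (c.Ds : ℝ) / 2 ^ r'.P) ⊆ D)
    (hy : ∀ ξ ∈ D, ∀ a, HasDerivAt (fun τ => y τ a) (F G'.g G'.Λ (y ξ) a + δF ξ a) ξ)
    (hδ : ∀ ξ ∈ Icc (σ - (c.Ds : ℝ) / 2 ^ r'.P) (σ + (c.Ds : ℝ) / 2 ^ r'.P), ∀ a,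
      |δF ξ a| ≤ ((max (r.DEL a) (r'.DEL a) : ℤ) : ℝ) / 2 ^ r'.P)
    (he : ∀ a, |y σ a - r'.X0R a| ≤ (r.Eb a : ℝ) / 2 ^ r'.P) :
    ∀ ξ ∈ Icc (σ - (c.Ds : ℝ) / 2 ^ r'.P) (σ + (c.Ds : ℝ) / 2 ^ r'.P), ∀ b,
      |y ξ b - r'.X0R b| < (c.wid b : ℝ) / 2 ^ r'.P := by
  intro ξ hξ
  have hO : (0 : ℝ) < 2 ^ r'.P := by positivity
  have hI := window_I W G' hD hy hδ he ξ hξ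
  have hτ' : |ξ - σ| ≤ (c.Ds : ℝ) / 2 ^ r'.P := abs_le.2 ⟨by linarith [hξ.1], by linarith [hξ.2]⟩
  have hτ : |ξ - σ| ≤ (((15 : Fin 16) : ℕ) + 1) * (((cdiv c.Ds 16 : ℤ) : ℝ) / 2 ^ r'.P) := by
    refine hτ'.trans ?_
    have h := div_le_cdiv (a := c.Ds) (b := 16) (by norm_num)
    push_cast at h
    have h2 : (c.Ds : ℝ) ≤ 16 * ((cdiv c.Ds 16 : ℤ) : ℝ) := by linarith
    have h3 : (c.Ds : ℝ) / 2 ^ r'.P ≤ 16 * (((cdiv c.Ds 16 : ℤ) : ℝ) / 2 ^ r'.P) := by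
      rw [← mul_div_assoc]; exact div_le_div_of_nonneg_right h2 hO.le
    norm_num
    exact h3
  have h15 : (15 : Fin 16).succ = Fin.last 16 := rfl
  exact (abs_dev_le W G' 15 (x := y ξ) (δ := δF ξ) (e := fun a => y σ a - r'.X0R a) (τ := ξ - σ) he
    (hδ ξ hξ) hτ hτ' (fun b => by rw [h15]; convert hI b using 2; ring)).1

end RowData

end RowCheck

end Summit.NavierStokesRegularity.FluidComputer
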